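import Literature.Probability.RandomPlanarGeometry.SAWLoopErasureMemoryTwoPenultimate
import Literature.Probability.FitznerVanDerHofstad2017.SawEndpointClasses
import Literature.Probability.FitznerVanDerHofstad2017.SrwWSplitJensenKernel
import HarnessLib

/-!
# Lattice symmetry of the memory-2 taboo counts — the reduction of Hara–Slade–Sokal (3.13) to three unknowns

Hara, Slade and Sokal [HSS93, §3.2 p. 18] solve the memory-2 identity (3.13) as a linear system:
"for a fixed `y`, (3.13) provides a system of `2d` linear equations for `2d` unknowns, namely
`{C^{A∪{b}}₂(y; b+f; β)}_{|f|=1}`. … Fortunately, the number of unknowns is often reduced by symmetry.  For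
example, for `y = 0`, `A = ∅` and `b = e₁`, there are three inequivalent values of `b + f`, namely `0`, `2e₁` and
`e₁ + e₂`.  Thus we can first solve the system of three equations in three unknowns which results by taking `x`
to be each of the three values `0`, `2e₁` and `e₁ + e₂`"; and for the loop bound (2.39) with `τ = 2̃`, `k = 1`
[HSS93, §4.1 p. 26]: "the loop generating functions `C̃^{{e₁};−e₁}₂(0,0;1/(2d−1))` and
`C̃^{{e₁};e₂}₂(0,0;1/(2d−1))` which by symmetry are the only two geometries to be considered."

This module supplies that symmetry for the finite sets of the tree's memory-2 loop erasure
(`SAWLoopErasureMemoryTwo`, `SAWLoopErasureMemoryTwoPenultimate`): the hyperoctahedral group `W_d` of signed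
coordinate permutations `φ = Site.signedPerm π ε` acts on directions by the tree's `stepPerm π ε` (`φ e_κ = e_{σκ}`,
`signedPerm_stepVec`) and on step words by `ω ↦ σ ∘ ω`; this action preserves non-backtracking, transports
positions (`pos (σ∘ω) k = φ (pos ω k)`) and hence

* `#nbwAvoidTo (φA) (φx) n = #nbwAvoidTo A x n` (`card_nbwAvoidTo_signedPerm`): the coefficients of the memory-2
  taboo two-point function `C^A₂(0,x;β)` are `W_d`-invariant;
* `#closedNbwPen (φA) (σs) n = #closedNbwPen A s n` (`card_closedNbwPen_signedPerm`): so are the coefficients of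
  the penalised loop generating function `C̃^{A;e_s}₂(0,0;β)`.

Since `W_d` is transitive on directions, on ordered pairs of perpendicular directions and on ordered triples of
pairwise perpendicular directions (`exists_stepPerm_apply_eq`, `_two`, `_three` — explicit products of
transpositions with adjusted signs), for the singleton taboo `A = {e_t}` of the `τ = 2̃, k = 1` bound:

* the loop counts `#closedNbwPen {e_t} s n` take ONE value on all straight geometries `s = −t` and ONE value on
  all bent geometries `s ⊥ t` (`card_closedNbwPen_singleton_srev_eq`, `card_closedNbwPen_singleton_perp_eq`) —
  "the only two geometries to be considered";
* the taboo counts `#nbwAvoidTo {e_t} (a·e_t + b·e_s) n` (`s ⊥ t`) do not depend on the perpendicular pair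
  `(t, s)` (`card_nbwAvoidTo_singleton_pair_eq`; with a third perpendicular direction,
  `card_nbwAvoidTo_singleton_triple_eq`): the `2d` unknowns `C^{{e_t}}₂(0; e_t − e_g)` of (3.13) at `y = 0` take the
  three values at `g = t` (`x = 0`), `g = −t` (`x = 2e_t`) and `g ⊥ t` (`x = e_t + e_s`, one common value);
* the simple-random-walk Green-function integrals `srwI d m l` of the tree are constant on the same orbits
  (`srwI_dir_pair_eq`, `srwI_dir_triple_eq`, from the tree's `signedPermInvariant_srwI`),

together with the bookkeeping that splits a sum over the `2d` directions by these classes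
(`sum_dir_eq_add_add_sum_filter`: `g = t`, `g = −t`, the `2d − 2` perpendicular ones; `sum_filter_fst_ne_eq`: a
further perpendicular pair and the `2d − 4` remaining ones).  No generating function is summed here; the statements
are identities of natural-number counts (and of the real numbers `srwI`), valid in every dimension `d`.
-/

noncomputable section

namespace Literature.Probability.RandomPlanarGeometry.SAW.Zd.LoopErasure

open Finset
open scoped BigOperators
open Literature.Probability.LatticeModels Literature.Probability.LatticeModels.SRW
open Literature.Probability.Percolation (IsNBW srev srev_srev srev_ne_self)
open Literature.Probability.FitznerVanDerHofstad2017 (stepPerm stepPerm_apply signedPerm_stepVec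
  wordPos_eq_pos wordPos_stepPerm_comp srwI signedPermInvariant_srwI)
open Literature.Barriers.CriticalPhenomena (signedPerm_eq_zero_iff)

variable {d : ℕ}

/-! ### Signed coordinate permutations on directions, sites and step words -/

/-- `φ_{π,ε} e_κ = e_{σ κ}` for the step map `SRW.stepVec` of the loop-erasure files (the statement of the tree's
`signedPerm_stepVec`, whose `stepVec` is definitionally the same map).
[cite: HaraSladeSokal1993, §4.1 p. 26 (symmetry reduction: "the only two geometries to be considered"); lane plumbing] -/
theorem signedPerm_srwStepVec (π : Equiv.Perm (Fin d)) (ε : Fin d → ℤˣ) (κ : Dir d) :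
    Site.signedPerm π ε (stepVec κ) = stepVec (stepPerm π ε κ) :=
  signedPerm_stepVec π ε κ

/-- The induced permutation of directions commutes with reversal: `σ(−κ) = −σ(κ)`.
[cite: HaraSladeSokal1993, §4.1 p. 26 (symmetry reduction: "the only two geometries to be considered"); lane plumbing] -/
theorem stepPerm_srev (π : Equiv.Perm (Fin d)) (ε : Fin d → ℤˣ) (κ : Dir d) :
    stepPerm π ε (srev κ) = srev (stepPerm π ε κ) := by
  obtain ⟨i, b⟩ := κ
  by_cases h : (ε (π i) : ℤ) = 1 <;> simp [stepPerm_apply, srev, h]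

/-- `φ` is `ℤ`-linear: `φ (a • x) = a • φ x`.
[cite: HaraSladeSokal1993, §4.1 p. 26 (symmetry reduction: "the only two geometries to be considered"); lane plumbing] -/
theorem signedPerm_zsmul (π : Equiv.Perm (Fin d)) (ε : Fin d → ℤˣ) (a : ℤ) (x : Site d) :
    Site.signedPerm π ε (a • x) = a • Site.signedPerm π ε x := by
  funext i
  simp [Site.signedPerm_apply, mul_left_comm]

/-- **`W_d` transports positions of step words**: `(σ ∘ ω)(k) = φ (ω(k))` for every `k`.
[cite: HaraSladeSokal1993, §4.1 p. 26 (symmetry reduction: "the only two geometries to be considered"); lane plumbing] -/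
theorem pos_stepPerm_comp (π : Equiv.Perm (Fin d)) (ε : Fin d → ℤˣ) {n : ℕ} (ω : StepSeq d n) (k : ℕ) :
    pos (stepPerm π ε ∘ ω) k = Site.signedPerm π ε (pos ω k) := by
  rcases le_total k n with hk | hk
  · rw [← wordPos_eq_pos _ hk, ← wordPos_eq_pos _ hk, wordPos_stepPerm_comp]
  · rw [pos_of_le _ hk, pos_of_le _ hk, ← pos_eq_endpoint, ← pos_eq_endpoint, ← wordPos_eq_pos _ le_rfl,
      ← wordPos_eq_pos _ le_rfl, wordPos_stepPerm_comp]

/-- `W_d` transports end points: `(σ ∘ ω)(n) = φ (ω(n))`.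
[cite: HaraSladeSokal1993, §4.1 p. 26 (symmetry reduction: "the only two geometries to be considered"); lane plumbing] -/
theorem endpoint_stepPerm_comp (π : Equiv.Perm (Fin d)) (ε : Fin d → ℤˣ) {n : ℕ} (ω : StepSeq d n) :
    endpoint (stepPerm π ε ∘ ω) = Site.signedPerm π ε (endpoint ω) := by
  rw [← pos_eq_endpoint, ← pos_eq_endpoint, pos_stepPerm_comp]

/-- Non-backtracking is `W_d`-invariant. [cite: HaraSladeSokal1993, §3.2 p. 18 ("reduced by symmetry")] -/
theorem isNBW_stepPerm_comp_iff (π : Equiv.Perm (Fin d)) (ε : Fin d → ℤˣ) {n : ℕ} (ω : StepSeq d n) :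
    IsNBW (stepPerm π ε ∘ ω) ↔ IsNBW ω := by
  simp only [IsNBW, Function.comp_apply, ne_eq, ← stepPerm_srev, (stepPerm π ε).injective.eq_iff]

/-! ### The taboo counts and the penalised loop counts are `W_d`-invariant -/

/-- `σ ∘ ω` is a memory-2 walk to `φ x` avoiding `φ A` iff `ω` is one to `x` avoiding `A`.
[cite: HaraSladeSokal1993, §3.2 p. 18 ("the number of unknowns is often reduced by symmetry")] -/
theorem stepPerm_comp_mem_nbwAvoidTo_iff (π : Equiv.Perm (Fin d)) (ε : Fin d → ℤˣ) (A : Finset (Site d))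
    (x : Site d) {n : ℕ} (ω : StepSeq d n) :
    stepPerm π ε ∘ ω ∈ nbwAvoidTo (A.image (Site.signedPerm π ε)) (Site.signedPerm π ε x) n ↔
      ω ∈ nbwAvoidTo A x n := by
  simp only [mem_nbwAvoidTo, isNBW_stepPerm_comp_iff, pos_stepPerm_comp, endpoint_stepPerm_comp,
    (Site.signedPerm π ε).injective.mem_finset_image, (Site.signedPerm π ε).injective.eq_iff]

/-- **`C^{φA}₂(0, φx; ·)` and `C^A₂(0, x; ·)` have the same coefficients**: `#nbwAvoidTo (φA) (φx) n = #nbwAvoidTo A x n`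
(`ω ↦ σ ∘ ω` is a bijection). [cite: HaraSladeSokal1993, §3.2 p. 18 ("the number of unknowns is often reduced by
symmetry")] -/
theorem card_nbwAvoidTo_signedPerm (π : Equiv.Perm (Fin d)) (ε : Fin d → ℤˣ) (A : Finset (Site d)) (x : Site d)
    (n : ℕ) : (nbwAvoidTo (A.image (Site.signedPerm π ε)) (Site.signedPerm π ε x) n).card = (nbwAvoidTo A x n).card := by
  symm
  refine card_nbij' (fun ω => stepPerm π ε ∘ ω) (fun ω => (stepPerm π ε).symm ∘ ω) (fun ω hω => ?_)
    (fun ω hω => ?_) (fun ω _ => ?_) (fun ω _ => ?_)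
  · exact (stepPerm_comp_mem_nbwAvoidTo_iff π ε A x ω).2 hω
  · have h : stepPerm π ε ∘ ((stepPerm π ε).symm ∘ ω) = ω := by funext i; simp
    rw [← h] at hω
    exact (stepPerm_comp_mem_nbwAvoidTo_iff π ε A x _).1 hω
  · funext i; simp
  · funext i; simp

/-- `σ ∘ ω` is a penalised memory-2 loop for `(φA, σs)` iff `ω` is one for `(A, s)`.
[cite: HaraSladeSokal1993, §4.1 p. 26 ("which by symmetry are the only two geometries to be considered")] -/
theorem stepPerm_comp_mem_closedNbwPen_iff (π : Equiv.Perm (Fin d)) (ε : Fin d → ℤˣ) (A : Finset (Site d))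
    (s : Dir d) {n : ℕ} (ω : StepSeq d n) :
    stepPerm π ε ∘ ω ∈ closedNbwPen (A.image (Site.signedPerm π ε)) (stepPerm π ε s) n ↔
      ω ∈ closedNbwPen A s n := by
  simp only [mem_closedNbwPen, isNBW_stepPerm_comp_iff, pos_stepPerm_comp, endpoint_stepPerm_comp,
    (Site.signedPerm π ε).injective.mem_finset_image, signedPerm_eq_zero_iff, Function.comp_apply,
    ← stepPerm_srev, ne_eq, (stepPerm π ε).injective.eq_iff]

/-- **`C̃^{φA; e_{σs}}₂(0,0; ·)` and `C̃^{A; e_s}₂(0,0; ·)` have the same coefficients**: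
`#closedNbwPen (φA) (σs) n = #closedNbwPen A s n`.
[cite: HaraSladeSokal1993, §4.1 p. 26 ("which by symmetry are the only two geometries to be considered")] -/
theorem card_closedNbwPen_signedPerm (π : Equiv.Perm (Fin d)) (ε : Fin d → ℤˣ) (A : Finset (Site d)) (s : Dir d)
    (n : ℕ) : (closedNbwPen (A.image (Site.signedPerm π ε)) (stepPerm π ε s) n).card = (closedNbwPen A s n).card := by
  symm
  refine card_nbij' (fun ω => stepPerm π ε ∘ ω) (fun ω => (stepPerm π ε).symm ∘ ω) (fun ω hω => ?_)
    (fun ω hω => ?_) (fun ω _ => ?_) (fun ω _ => ?_)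
  · exact (stepPerm_comp_mem_closedNbwPen_iff π ε A s ω).2 hω
  · have h : stepPerm π ε ∘ ((stepPerm π ε).symm ∘ ω) = ω := by funext i; simp
    rw [← h] at hω
    exact (stepPerm_comp_mem_closedNbwPen_iff π ε A s _).1 hω
  · funext i; simp
  · funext i; simp

/-! ### Transitivity of `W_d` on directions, perpendicular pairs and perpendicular triples -/

/-- A permutation of the axes with two prescribed values.
[cite: HaraSladeSokal1993, §4.1 p. 26 (symmetry reduction: "the only two geometries to be considered"); lane plumbing] -/
theorem exists_perm_apply_eq_two {i j i' j' : Fin d} (h : i ≠ j) (h' : i' ≠ j') :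
    ∃ π : Equiv.Perm (Fin d), π i = i' ∧ π j = j' := by
  classical
  have hu : Equiv.swap i i' j ≠ i' := by
    intro hc
    exact h ((Equiv.swap i i').injective (hc.trans (Equiv.swap_apply_left i i').symm)).symm
  refine ⟨Equiv.swap (Equiv.swap i i' j) j' * Equiv.swap i i', ?_, ?_⟩
  · rw [Equiv.Perm.mul_apply, Equiv.swap_apply_left, Equiv.swap_apply_of_ne_of_ne hu.symm h']
  · rw [Equiv.Perm.mul_apply, Equiv.swap_apply_left]

/-- A permutation of the axes with three prescribed values.
[cite: HaraSladeSokal1993, §4.1 p. 26 (symmetry reduction: "the only two geometries to be considered"); lane plumbing] -/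
theorem exists_perm_apply_eq_three {i j k i' j' k' : Fin d} (hij : i ≠ j) (hik : i ≠ k) (hjk : j ≠ k)
    (hij' : i' ≠ j') (hik' : i' ≠ k') (hjk' : j' ≠ k') :
    ∃ π : Equiv.Perm (Fin d), π i = i' ∧ π j = j' ∧ π k = k' := by
  classical
  obtain ⟨π, h₁, h₂⟩ := exists_perm_apply_eq_two hij hij'
  have hv₁ : π k ≠ i' := fun hc => hik (π.injective (h₁.trans hc.symm))
  have hv₂ : π k ≠ j' := fun hc => hjk (π.injective (h₂.trans hc.symm))
  refine ⟨Equiv.swap (π k) k' * π, ?_, ?_, ?_⟩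
  · rw [Equiv.Perm.mul_apply, h₁, Equiv.swap_apply_of_ne_of_ne hv₁.symm hik']
  · rw [Equiv.Perm.mul_apply, h₂, Equiv.swap_apply_of_ne_of_ne hv₂.symm hjk']
  · rw [Equiv.Perm.mul_apply, Equiv.swap_apply_left]

/-- Realising a prescribed direction: if `π` sends the axis of `κ` to the axis of `κ'` and the sign `ε` at that
axis is `+1` or `−1` according as the orientations of `κ, κ'` agree or differ, then `σ κ = κ'`.
[cite: HaraSladeSokal1993, §4.1 p. 26 (symmetry reduction: "the only two geometries to be considered"); lane plumbing] -/
theorem stepPerm_apply_eq_of {π : Equiv.Perm (Fin d)} {ε : Fin d → ℤˣ} {κ κ' : Dir d} (hπ : π κ.1 = κ'.1)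
    (hε : ε κ'.1 = if κ.2 = κ'.2 then 1 else -1) : stepPerm π ε κ = κ' := by
  obtain ⟨i, b⟩ := κ
  obtain ⟨i', b'⟩ := κ'
  simp only at hπ hε
  subst hπ
  rw [stepPerm_apply]
  simp only [hε]
  cases b <;> cases b' <;> simp

/-- **`W_d` is transitive on the `2d` directions.**
[cite: HaraSladeSokal1993, §4.1 p. 26 (symmetry reduction: "the only two geometries to be considered"); lane plumbing] -/
theorem exists_stepPerm_apply_eq (κ κ' : Dir d) :
    ∃ (π : Equiv.Perm (Fin d)) (ε : Fin d → ℤˣ), stepPerm π ε κ = κ' := by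
  classical
  exact ⟨Equiv.swap κ.1 κ'.1, fun i => if i = κ'.1 then (if κ.2 = κ'.2 then 1 else -1) else 1,
    stepPerm_apply_eq_of (Equiv.swap_apply_left _ _) (by simp)⟩

/-- **`W_d` is transitive on ordered pairs of perpendicular directions.**
[cite: HaraSladeSokal1993, §4.1 p. 26 (symmetry reduction: "the only two geometries to be considered"); lane plumbing] -/
theorem exists_stepPerm_apply_eq_two {t s t' s' : Dir d} (h : t.1 ≠ s.1) (h' : t'.1 ≠ s'.1) :
    ∃ (π : Equiv.Perm (Fin d)) (ε : Fin d → ℤˣ), stepPerm π ε t = t' ∧ stepPerm π ε s = s' := by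
  classical
  obtain ⟨π, hπt, hπs⟩ := exists_perm_apply_eq_two h h'
  refine ⟨π, fun i => if i = t'.1 then (if t.2 = t'.2 then 1 else -1)
    else if i = s'.1 then (if s.2 = s'.2 then 1 else -1) else 1, ?_, ?_⟩
  · exact stepPerm_apply_eq_of hπt (by simp)
  · exact stepPerm_apply_eq_of hπs (by simp [h'.symm])

/-- **`W_d` is transitive on ordered triples of pairwise perpendicular directions.**
[cite: HaraSladeSokal1993, §4.1 p. 26 (symmetry reduction: "the only two geometries to be considered"); lane plumbing] -/
theorem exists_stepPerm_apply_eq_three {t s r t' s' r' : Dir d} (hts : t.1 ≠ s.1) (htr : t.1 ≠ r.1)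
    (hsr : s.1 ≠ r.1) (hts' : t'.1 ≠ s'.1) (htr' : t'.1 ≠ r'.1) (hsr' : s'.1 ≠ r'.1) :
    ∃ (π : Equiv.Perm (Fin d)) (ε : Fin d → ℤˣ),
      stepPerm π ε t = t' ∧ stepPerm π ε s = s' ∧ stepPerm π ε r = r' := by
  classical
  obtain ⟨π, hπt, hπs, hπr⟩ := exists_perm_apply_eq_three hts htr hsr hts' htr' hsr'
  refine ⟨π, fun i => if i = t'.1 then (if t.2 = t'.2 then 1 else -1)
    else if i = s'.1 then (if s.2 = s'.2 then 1 else -1)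
    else if i = r'.1 then (if r.2 = r'.2 then 1 else -1) else 1, ?_, ?_, ?_⟩
  · exact stepPerm_apply_eq_of hπt (by simp)
  · exact stepPerm_apply_eq_of hπs (by simp [hts'.symm])
  · exact stepPerm_apply_eq_of hπr (by simp [htr'.symm, hsr'.symm])

/-! ### The two loop geometries and the three taboo unknowns of the `τ = 2̃`, `k = 1` bound -/

/-- **Straight geometries are all equivalent**: `#closedNbwPen {e_t} (−t) n` does not depend on `t`.
[cite: HaraSladeSokal1993, §4.1 p. 26 ("which by symmetry are the only two geometries to be considered")] -/
theorem card_closedNbwPen_singleton_srev_eq (t t' : Dir d) (n : ℕ) :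
    (closedNbwPen {stepVec t} (srev t) n).card = (closedNbwPen {stepVec t'} (srev t') n).card := by
  obtain ⟨π, ε, ht⟩ := exists_stepPerm_apply_eq t t'
  rw [← card_closedNbwPen_signedPerm π ε {stepVec t} (srev t) n]
  simp only [image_singleton, signedPerm_srwStepVec, stepPerm_srev, ht]

/-- **Bent geometries are all equivalent**: `#closedNbwPen {e_t} s n` takes one value on all `s ⊥ t`.
[cite: HaraSladeSokal1993, §4.1 p. 26 ("which by symmetry are the only two geometries to be considered")] -/
theorem card_closedNbwPen_singleton_perp_eq {t s t' s' : Dir d} (h : t.1 ≠ s.1) (h' : t'.1 ≠ s'.1) (n : ℕ) :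
    (closedNbwPen {stepVec t} s n).card = (closedNbwPen {stepVec t'} s' n).card := by
  obtain ⟨π, ε, ht, hs⟩ := exists_stepPerm_apply_eq_two h h'
  rw [← card_closedNbwPen_signedPerm π ε {stepVec t} s n]
  simp only [image_singleton, signedPerm_srwStepVec, ht, hs]

/-- The taboo counts `#nbwAvoidTo {e_t} (a·e_t) n` along the taboo axis do not depend on `t` (`a = 0, 2, −1`:
the sites `0`, `2e_t`, `−e_t`). [cite: HaraSladeSokal1993, §3.2 p. 18 ("three inequivalent values of b+f, namely
0, 2e₁ and e₁+e₂")] -/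
theorem card_nbwAvoidTo_singleton_zsmul_eq (t t' : Dir d) (a : ℤ) (n : ℕ) :
    (nbwAvoidTo {stepVec t} (a • stepVec t) n).card = (nbwAvoidTo {stepVec t'} (a • stepVec t') n).card := by
  obtain ⟨π, ε, ht⟩ := exists_stepPerm_apply_eq t t'
  rw [← card_nbwAvoidTo_signedPerm π ε {stepVec t} _ n]
  simp only [image_singleton, signedPerm_srwStepVec, signedPerm_zsmul, ht]

/-- **The perpendicular unknowns coincide**: `#nbwAvoidTo {e_t} (a·e_t + b·e_s) n` takes one value on all
perpendicular pairs `(t, s)` (`(a,b) = (1,−1)`: the unknowns `C^{{e_t}}₂(0; e_t − e_g)`, `g ⊥ t`, of (3.13);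
`(1,1)`, `(0,1)`: the sites `e_t + e_s`, `e_s`). [cite: HaraSladeSokal1993, §3.2 p. 18 ("three inequivalent values
of b+f, namely 0, 2e₁ and e₁+e₂")] -/
theorem card_nbwAvoidTo_singleton_pair_eq {t s t' s' : Dir d} (h : t.1 ≠ s.1) (h' : t'.1 ≠ s'.1) (a b : ℤ)
    (n : ℕ) : (nbwAvoidTo {stepVec t} (a • stepVec t + b • stepVec s) n).card =
      (nbwAvoidTo {stepVec t'} (a • stepVec t' + b • stepVec s') n).card := by
  obtain ⟨π, ε, ht, hs⟩ := exists_stepPerm_apply_eq_two h h'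
  rw [← card_nbwAvoidTo_signedPerm π ε {stepVec t} _ n]
  simp only [image_singleton, signedPerm_srwStepVec, Site.signedPerm_add, signedPerm_zsmul, ht, hs]

/-- Three-direction version: `#nbwAvoidTo {e_t} (a·e_t + b·e_s + c·e_r) n` takes one value on all ordered triples
of pairwise perpendicular directions. [cite: HaraSladeSokal1993, Appendix B p. 32 ("By symmetry, we can reduce
(3.13) to a system of equations for a number of unknowns which is uniformly bounded in d")] -/
theorem card_nbwAvoidTo_singleton_triple_eq {t s r t' s' r' : Dir d} (hts : t.1 ≠ s.1) (htr : t.1 ≠ r.1)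
    (hsr : s.1 ≠ r.1) (hts' : t'.1 ≠ s'.1) (htr' : t'.1 ≠ r'.1) (hsr' : s'.1 ≠ r'.1) (a b c : ℤ) (n : ℕ) :
    (nbwAvoidTo {stepVec t} (a • stepVec t + b • stepVec s + c • stepVec r) n).card =
      (nbwAvoidTo {stepVec t'} (a • stepVec t' + b • stepVec s' + c • stepVec r') n).card := by
  obtain ⟨π, ε, ht, hs, hr⟩ := exists_stepPerm_apply_eq_three hts htr hsr hts' htr' hsr'
  rw [← card_nbwAvoidTo_signedPerm π ε {stepVec t} _ n]
  simp only [image_singleton, signedPerm_srwStepVec, Site.signedPerm_add, signedPerm_zsmul, ht, hs, hr]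

/-! ### The Green-function integrals are constant on the same orbits -/

/-- `srwI d m l (a·e_t)` does not depend on the direction `t`.
[cite: HaraSladeSokal1993, App. A.1 p. 27 (lattice symmetry of C₀); lane plumbing] -/
theorem srwI_dir_eq (t t' : Dir d) (a : ℤ) (m l : ℕ) :
    srwI d m l (a • stepVec t) = srwI d m l (a • stepVec t') := by
  obtain ⟨π, ε, ht⟩ := exists_stepPerm_apply_eq t t'
  have hφ : srwI d m l (Site.signedPerm π ε (a • stepVec t)) = srwI d m l (a • stepVec t) :=
    signedPermInvariant_srwI m l π ε _
  rw [← hφ]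
  simp only [signedPerm_zsmul, signedPerm_srwStepVec, ht]

/-- `srwI d m l (a·e_t + b·e_s)` takes one value on all perpendicular pairs `(t, s)`.
[cite: HaraSladeSokal1993, App. A.1 p. 27 (lattice symmetry of C₀); lane plumbing] -/
theorem srwI_dir_pair_eq {t s t' s' : Dir d} (h : t.1 ≠ s.1) (h' : t'.1 ≠ s'.1) (a b : ℤ) (m l : ℕ) :
    srwI d m l (a • stepVec t + b • stepVec s) = srwI d m l (a • stepVec t' + b • stepVec s') := by
  obtain ⟨π, ε, ht, hs⟩ := exists_stepPerm_apply_eq_two h h'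
  have hφ : srwI d m l (Site.signedPerm π ε (a • stepVec t + b • stepVec s)) =
      srwI d m l (a • stepVec t + b • stepVec s) :=
    signedPermInvariant_srwI m l π ε _
  rw [← hφ]
  simp only [Site.signedPerm_add, signedPerm_zsmul, signedPerm_srwStepVec, ht, hs]

/-- `srwI d m l (a·e_t + b·e_s + c·e_r)` takes one value on all ordered triples of pairwise perpendicular
directions. [cite: HaraSladeSokal1993, App. A.1 p. 27 (lattice symmetry of C₀); lane plumbing] -/
theorem srwI_dir_triple_eq {t s r t' s' r' : Dir d} (hts : t.1 ≠ s.1) (htr : t.1 ≠ r.1) (hsr : s.1 ≠ r.1)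
    (hts' : t'.1 ≠ s'.1) (htr' : t'.1 ≠ r'.1) (hsr' : s'.1 ≠ r'.1) (a b c : ℤ) (m l : ℕ) :
    srwI d m l (a • stepVec t + b • stepVec s + c • stepVec r) =
      srwI d m l (a • stepVec t' + b • stepVec s' + c • stepVec r') := by
  obtain ⟨π, ε, ht, hs, hr⟩ := exists_stepPerm_apply_eq_three hts htr hsr hts' htr' hsr'
  have hφ : srwI d m l (Site.signedPerm π ε (a • stepVec t + b • stepVec s + c • stepVec r)) =
      srwI d m l (a • stepVec t + b • stepVec s + c • stepVec r) :=
    signedPermInvariant_srwI m l π ε _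
  rw [← hφ]
  simp only [Site.signedPerm_add, signedPerm_zsmul, signedPerm_srwStepVec, ht, hs, hr]

/-! ### Splitting a sum over the `2d` directions by the classes relative to a direction -/

/-- Two directions share an axis iff they are equal or opposite.
[cite: HaraSladeSokal1993, §3.2 p. 18 ("three inequivalent values of b+f"); lane plumbing] -/
theorem dir_fst_eq_iff {g t : Dir d} : g.1 = t.1 ↔ g = t ∨ g = srev t := by
  constructor
  · intro h
    obtain ⟨i, b⟩ := g
    obtain ⟨j, c⟩ := t
    simp only at h
    subst h
    cases b <;> cases c <;> simp [srev]
  · rintro (rfl | rfl) <;> rfl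

/-- The directions along the axis of `t` are `t` and `−t`.
[cite: HaraSladeSokal1993, §3.2 p. 18 ("three inequivalent values of b+f"); lane plumbing] -/
theorem filter_fst_eq_eq_pair (t : Dir d) : (univ.filter fun g : Dir d => g.1 = t.1) = {t, srev t} := by
  ext g
  simp [dir_fst_eq_iff]

/-- **Splitting `Σ_g` by the axis of `t`**: `Σ_g F g = F t + F (−t) + Σ_{g ⊥ t} F g`.
[cite: HaraSladeSokal1993, §3.2 p. 18 ("three inequivalent values of b+f")] -/
theorem sum_dir_eq_add_add_sum_filter {M : Type*} [AddCommMonoid M] (F : Dir d → M) (t : Dir d) :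
    ∑ g, F g = F t + F (srev t) + ∑ g ∈ univ.filter (fun g : Dir d => g.1 ≠ t.1), F g := by
  rw [← sum_filter_add_sum_filter_not univ (fun g : Dir d => g.1 = t.1), filter_fst_eq_eq_pair,
    sum_pair (srev_ne_self t).symm]

/-- There are `2d − 2` directions perpendicular to `t`.
[cite: HaraSladeSokal1993, §3.2 p. 18 ("three inequivalent values of b+f"); lane plumbing] -/
theorem card_univ_filter_dir_fst_ne (t : Dir d) : (univ.filter fun g : Dir d => g.1 ≠ t.1).card = 2 * d - 2 := by
  have h := card_filter_add_card_filter_not (s := (univ : Finset (Dir d))) (fun g : Dir d => g.1 = t.1)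
  rw [filter_fst_eq_eq_pair, card_pair (srev_ne_self t).symm, card_univ, Fintype.card_prod, Fintype.card_fin,
    Fintype.card_bool] at h
  simp only [ne_eq]
  omega

/-- **Splitting `Σ_{g ⊥ t}` by the axis of a perpendicular direction `u`**:
`Σ_{g ⊥ t} F g = F u + F (−u) + Σ_{g ⊥ t, g ⊥ u} F g`. [cite: HaraSladeSokal1993, Appendix B p. 32 ("a number of
unknowns which is uniformly bounded in d")] -/
theorem sum_filter_fst_ne_eq {M : Type*} [AddCommMonoid M] (F : Dir d → M) {t u : Dir d} (hut : u.1 ≠ t.1) :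
    ∑ g ∈ univ.filter (fun g : Dir d => g.1 ≠ t.1), F g =
      F u + F (srev u) + ∑ g ∈ univ.filter (fun g : Dir d => g.1 ≠ t.1 ∧ g.1 ≠ u.1), F g := by
  have hpair : (univ.filter fun g : Dir d => g.1 ≠ t.1 ∧ g.1 = u.1) = {u, srev u} := by
    ext g
    simp only [mem_filter, mem_univ, true_and, mem_insert, mem_singleton]
    constructor
    · exact fun hg => dir_fst_eq_iff.1 hg.2
    · intro hg
      have h1 : g.1 = u.1 := dir_fst_eq_iff.2 hg
      exact ⟨by rw [h1]; exact hut, h1⟩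
  rw [← sum_filter_add_sum_filter_not (univ.filter fun g : Dir d => g.1 ≠ t.1) (fun g : Dir d => g.1 = u.1),
    filter_filter, filter_filter, hpair, sum_pair (srev_ne_self u).symm]

/-- There are `2d − 4` directions perpendicular to two perpendicular directions `t, u`.
[cite: HaraSladeSokal1993, §3.2 p. 18 ("three inequivalent values of b+f"); lane plumbing] -/
theorem card_univ_filter_dir_fst_ne_ne {t u : Dir d} (hut : u.1 ≠ t.1) :
    (univ.filter fun g : Dir d => g.1 ≠ t.1 ∧ g.1 ≠ u.1).card = 2 * d - 4 := by
  have h := sum_filter_fst_ne_eq (fun _ : Dir d => (1 : ℕ)) hut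
  simp only [sum_const, smul_eq_mul, mul_one, card_univ_filter_dir_fst_ne t] at h
  omega

end Literature.Probability.RandomPlanarGeometry.SAW.Zd.LoopErasure
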